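import Summits.Ventures.Crystal3D.Theorems.StickyWulffConstantCoaxialWallLawTwinAbsorption
import HarnessLib

/-!
# The crude absorption inequality for a translation pair, under the axis rule

HONEST FRAMING. Part of the venture `Summits/Ventures/Crystal3D` (cell `crystal3d-full`), helper
`--supports` the crux `CoaxialWallLaw` (stmt-Ventures-19481, `route-Ventures-StickyWulffConstant`),
REGISTERED line `WallLedgerF` (planner cf-p1 gen 16), stub `stub_coaxialTwoSlabAdhesion`
(terrace/riser slot ledger).  The second co-axial family: TRANSLATION pairs `Λ₁`, `Λ₂ = Λ₁ + s`
(same frame, both grains in the fcc word or both in the twin word).  Here the face-twin pattern of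
`absorption_inPlane_or_faceTwin` IS possible (the free `…ABC|BCA…` stacking-fault wall about
another `⟨111⟩` axis: finding of seat g0, RISER-LEDGER-FINDINGS §3), but only when the offset is a
Shockley-partial class: the three twin positions over a face `w₁, w₂, w₃` of `x ∈ Λ₀` are
`x + (2/3)(w₁+w₂+w₃) − wⱼ`, and they lie on `Λ₀ + s` iff `(2/3)(w₁+w₂+w₃) − s ∈ Λ₀`.  The AXIS
RULE of the line (the defender chooses the shared axis `m` so that no INCLINED face of the slot
shell has its class `(2/3)(w₁+w₂+w₃)` congruent to `s`) is therefore taken as a hypothesis here: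

* `translate_absorption_inPlane` — host `Λ₀`, foreign `Λ₀ + s`, `X ⊆ Λ₀ ∪ (Λ₀ + s)` a unit
  packing, `x ∈ Λ₀ ∖ (Λ₀ + s)`, and `(2/3)(w₁+w₂+w₃) − s ∉ Λ₀` for every triangular face
  `w₁, w₂, w₃` of the slot shell with `w₁` horizontal: then
  `#{vacant in-plane slots of x} + 4 · deg_X(x) ≤ 48`;
* `translate_absorption_inPlane_moved` — the same for host `M·Λ₀ + t`, foreign `M·Λ₀ + t'`
  (axis hypothesis on `M⁻¹(t' − t)`).

WHAT THIS IS NOT: the choice of the adapted axis (that at most one face class, up to sign, is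
congruent to a given offset, and that every `⟨111⟩` axis of `Λ₁` carries a Barlow frame), the cell
bookkeeping; rung F-C1 not moved.
-/

noncomputable section

namespace Summit.Ventures.Crystal3D.Theorems

open Summit.Ventures.Crystal3D Finset
open Literature.MathematicalPhysics.StatisticalMechanics (fccStacking)

/-- **Crude absorption, translation pair, host on the model grain** (axis rule as hypothesis). -/
theorem translate_absorption_inPlane (s : EuclideanSpace ℝ (Fin 3))
    (X : Finset (EuclideanSpace ℝ (Fin 3)))
    (hX : ∀ p ∈ X, ∀ q ∈ X, p ≠ q → 1 ≤ dist p q)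
    (hXΛ : ∀ p ∈ X, p ∈ fccStacking 1 (Real.sqrt (2 / 3)) ∨
      p ∈ (fun q => q + s) '' fccStacking 1 (Real.sqrt (2 / 3)))
    (x : EuclideanSpace ℝ (Fin 3)) (hxΛ : x ∈ fccStacking 1 (Real.sqrt (2 / 3)))
    (hxs : x ∉ (fun q => q + s) '' fccStacking 1 (Real.sqrt (2 / 3)))
    (haxis : ∀ w₁ ∈ fccSlots, ∀ w₂ ∈ fccSlots, ∀ w₃ ∈ fccSlots,
      dist w₁ w₂ = 1 → dist w₁ w₃ = 1 → dist w₂ w₃ = 1 → w₁ 2 = 0 →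
      (2 / 3 : ℝ) • (w₁ + w₂ + w₃) - s ∉ fccStacking 1 (Real.sqrt (2 / 3))) :
    (fccSlots.filter fun w => w 2 = 0 ∧ x + w ∉ X).card +
      4 * (X.filter fun y => dist x y = 1).card ≤ 48 := by
  have hset : (fun q => (LinearIsometryEquiv.refl ℝ (EuclideanSpace ℝ (Fin 3))) q + s) ''
      fccStacking 1 (Real.sqrt (2 / 3)) = (fun q => q + s) '' fccStacking 1 (Real.sqrt (2 / 3)) := by
    rfl
  rcases absorption_inPlane_or_faceTwin (LinearIsometryEquiv.refl ℝ _) s X hX (by rw [hset]; exact hXΛ)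
      x hxΛ (by rw [hset]; exact hxs) with h | ⟨w₁, hw₁, w₂, hw₂, w₃, hw₃, -, -, -, d12, d13, d23, h0,
      -, -, -, ⟨-, hτ₁⟩, -, -⟩
  · exact h
  exfalso
  rw [hset] at hτ₁
  obtain ⟨q, hq, hq'⟩ := hτ₁
  apply haxis w₁ hw₁ w₂ hw₂ w₃ hw₃ d12 d13 d23 h0
  -- `(2/3)(w₁+w₂+w₃) − s = (q − x) + w₁ ∈ Λ₀`
  have he : (2 / 3 : ℝ) • (w₁ + w₂ + w₃) - s = q - x + w₁ := by
    have hq'' : q + s = x + ((2 / 3 : ℝ) • (w₁ + w₂ + w₃) - w₁) := hq'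
    have hs' : s = x + ((2 / 3 : ℝ) • (w₁ + w₂ + w₃) - w₁) - q := by rw [← hq'']; abel
    rw [hs']; abel
  rw [he]
  exact fcc_add_site_mem (fcc_sub_site_mem hq hxΛ) (mem_fcc_of_mem_fccSlots hw₁)

/-- **Crude absorption, translation pair, host grain `M·Λ₀ + t`, foreign grain `M·Λ₀ + t'`** (axis
rule as hypothesis, on the pulled-back offset `M⁻¹(t' − t)`). -/
theorem translate_absorption_inPlane_moved
    (M : EuclideanSpace ℝ (Fin 3) ≃ₗᵢ[ℝ] EuclideanSpace ℝ (Fin 3)) (t t' : EuclideanSpace ℝ (Fin 3))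
    (X : Finset (EuclideanSpace ℝ (Fin 3)))
    (hX : ∀ p ∈ X, ∀ q ∈ X, p ≠ q → 1 ≤ dist p q)
    (hXΛ : ∀ p ∈ X, p ∈ (fun q => M q + t) '' fccStacking 1 (Real.sqrt (2 / 3)) ∨
      p ∈ (fun q => M q + t') '' fccStacking 1 (Real.sqrt (2 / 3)))
    (x : EuclideanSpace ℝ (Fin 3)) (hx : x ∈ (fun q => M q + t) '' fccStacking 1 (Real.sqrt (2 / 3)))
    (hx' : x ∉ (fun q => M q + t') '' fccStacking 1 (Real.sqrt (2 / 3)))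
    (haxis : ∀ w₁ ∈ fccSlots, ∀ w₂ ∈ fccSlots, ∀ w₃ ∈ fccSlots,
      dist w₁ w₂ = 1 → dist w₁ w₃ = 1 → dist w₂ w₃ = 1 → w₁ 2 = 0 →
      (2 / 3 : ℝ) • (w₁ + w₂ + w₃) - M.symm (t' - t) ∉ fccStacking 1 (Real.sqrt (2 / 3))) :
    (fccSlots.filter fun w => w 2 = 0 ∧ x + M w ∉ X).card +
      4 * (X.filter fun y => dist x y = 1).card ≤ 48 := by
  classical
  -- pull back by `f p = M⁻¹ (p − t)`
  set f : EuclideanSpace ℝ (Fin 3) → EuclideanSpace ℝ (Fin 3) := fun p => M.symm (p - t) with hf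
  have hfd : ∀ u w, dist (f u) (f w) = dist u w := by
    intro u w; simp only [hf]; rw [LinearIsometryEquiv.dist_map, dist_sub_right]
  have hinj : Function.Injective f := by
    intro u w huw
    have : u - t = w - t := M.symm.injective huw
    simpa using this
  have hfinv : ∀ p, f (M p + t) = p := fun p => by simp [hf]
  set s := M.symm (t' - t) with hs
  have hftwin : ∀ q, f (M q + t') = q + s := by
    intro q
    simp only [hf, hs]
    rw [show M q + t' - t = M q + (t' - t) by abel, map_add, LinearIsometryEquiv.symm_apply_apply]
  set X' := X.image f with hX'
  -- the pulled-back packing lives on `Λ₀ ∪ (Λ₀ + s)`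
  have hX'pack : ∀ p ∈ X', ∀ q ∈ X', p ≠ q → 1 ≤ dist p q := by
    intro p hp q hq hpq
    obtain ⟨p₀, hp₀, rfl⟩ := mem_image.1 hp
    obtain ⟨q₀, hq₀, rfl⟩ := mem_image.1 hq
    rw [hfd]
    exact hX p₀ hp₀ q₀ hq₀ fun e => hpq (by rw [e])
  have hX'Λ : ∀ p ∈ X', p ∈ fccStacking 1 (Real.sqrt (2 / 3)) ∨
      p ∈ (fun q => q + s) '' fccStacking 1 (Real.sqrt (2 / 3)) := by
    intro p hp
    obtain ⟨p₀, hp₀, rfl⟩ := mem_image.1 hp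
    rcases hXΛ p₀ hp₀ with ⟨q, hq, hq'⟩ | ⟨q, hq, hq'⟩
    · left; rw [← hq', hfinv]; exact hq
    · right
      refine ⟨q, hq, ?_⟩
      rw [← hq']
      exact (hftwin q).symm
  obtain ⟨x₀, hx₀, hx₀'⟩ := hx
  have hfx : f x = x₀ := by rw [← hx₀', hfinv]
  have hfxΛ : f x ∈ fccStacking 1 (Real.sqrt (2 / 3)) := by rw [hfx]; exact hx₀
  have hfxs : f x ∉ (fun q => q + s) '' fccStacking 1 (Real.sqrt (2 / 3)) := by
    rintro ⟨q, hq, hq'⟩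
    apply hx'
    refine ⟨q, hq, ?_⟩
    apply hinj
    show f (M q + t') = f x
    exact (hftwin q).trans hq'
  have key := translate_absorption_inPlane s X' hX'pack hX'Λ (f x) hfxΛ hfxs haxis
  -- translate the two counts back
  have hdeg : (X'.filter fun y => dist (f x) y = 1).card = (X.filter fun y => dist x y = 1).card := by
    rw [hX', filter_image, card_image_of_injective _ hinj]
    congr 1
    exact filter_congr fun y _ => by simp [hfd]
  have hslot : (fccSlots.filter fun w => w 2 = 0 ∧ f x + w ∉ X') =
      fccSlots.filter fun w => w 2 = 0 ∧ x + M w ∉ X := by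
    refine filter_congr fun w _ => ?_
    have hfw : f (x + M w) = f x + w := by
      simp only [hf]
      rw [show x + M w - t = (x - t) + M w by abel, map_add, LinearIsometryEquiv.symm_apply_apply]
    rw [← hfw, hX', Function.Injective.mem_finset_image hinj]
  rw [hdeg, hslot] at key
  exact key


end Summit.Ventures.Crystal3D.Theorems

end
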